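import Literature.NumberTheory.EllipticCurves.SerreOpenImageSupersingularValuationProofs
import HarnessLib

/-!
# The parameter `t = x/y` on `E[ℓ]` at a good supersingular prime (Serre 1972, §1.11)

Topic `NumberTheory/EllipticCurves`.  Theorems only (nothing is defined, no named fact).
Continuation of `SerreOpenImageSupersingularValuationProofs`: `E = W/ℚ` in global minimal form,
`ℓ` an odd prime of good supersingular reduction (`ℓ ∣ a_ℓ`), `v` the valuation of the place
`placeOver ℓ` of `ℚ̄`.  For a nonzero `ℓ`-torsion point `P = (x, y) ∈ E(ℚ̄)` we study the
"parameter at the origin" `t(P) = x/y` (Serre, §1.10–1.11: the coordinate on the formal group,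
up to sign) and prove, by elementary valuation estimates from the Weierstrass equation and the
results on `ψ_ℓ`:

* `valuation_X_lt_valuation_Y` — `v(y)² = v(x)³` and `v(x) < v(y)` (so `y ≠ 0`);
* `valuation_param_sq_mul`, `valuation_param_pow_eq` — `v(t)² v(x) = 1` and
  `v(t)^{ℓ² - 1} = v(ℓ)`, `v(t) < 1`: **the parameters of the nonzero points of `E[ℓ]` all have
  valuation `1/(ℓ² - 1)`** (Serre 1972, §1.11, Prop. 12, `e = 1`; "hauteur 2");
* `valuation_param_sub_eq` — **for `P ≠ Q` nonzero in `E[ℓ]`, `v(t(P) - t(Q)) = v(t(P))`**: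
  distinct points have parameters as far apart as possible (this injectivity of
  `P ↦ t(P) mod 𝔪^{>1/(ℓ²-1)}` is what makes the image of inertia on `E[ℓ]` visible on the tame
  character `s ↦ s(t)/t`, cf. Serre's Prop. 9–10 where it comes from the formal group law).

## References

* [Serre1972] J.-P. Serre, Invent. Math. 15 (1972) 259–331, §1.9–1.11 (Prop. 9, 10, 12).
* [SilvermanAEC2009] J. H. Silverman, *The Arithmetic of Elliptic Curves*, 2nd ed. (2009),
  IV.§1 (`z = -x/y`), VII.§2–3.
-/

noncomputable section

open scoped Classical
open Polynomial WeierstrassCurve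

namespace Literature.NumberTheory.EllipticCurves

variable (ℓ : ℕ) [Fact ℓ.Prime] {W : WeierstrassCurve ℚ} [W.IsGloballyMinimal]

/-- The Weierstrass equation of a geometric point of `E = W/ℚ` (globally minimal), written with
the integer coefficients `aᵢ` of the minimal model read in `ℚ̄`. [folklore] -/
theorem equation_intCast_of_eq_some {P : W.geomPoints} {x y : AlgebraicClosure ℚ} {h}
    (_hPxy : P = .some x y h) :
    y ^ 2 + ((integralModelInt W).a₁ : AlgebraicClosure ℚ) * x * y +
        ((integralModelInt W).a₃ : AlgebraicClosure ℚ) * y =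
      x ^ 3 + ((integralModelInt W).a₂ : AlgebraicClosure ℚ) * x ^ 2 +
        ((integralModelInt W).a₄ : AlgebraicClosure ℚ) * x + (integralModelInt W).a₆ := by
  have e : @WeierstrassCurve.baseChange ℚ _ W (AlgebraicClosure ℚ) _
        (@AlgebraicClosure.instAlgebra ℚ _ ℚ _ _) =
      (integralModelInt W).map (Int.castRingHom (AlgebraicClosure ℚ)) := by
    conv_lhs => rw [← map_integralModelInt W]
    rw [baseChange, WeierstrassCurve.map_map]
    exact congrArg (integralModelInt W).map (RingHom.ext_int _ _)
  have heq := h.left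
  rw [e, Affine.equation_iff] at heq
  exact heq

/-- The negative of a geometric point `(x, y)` is `(x, -y - a₁x - a₃)` with the integer
coefficients of the minimal model: two distinct points of `E(ℚ̄)` with the same abscissa are
opposite. [folklore] -/
theorem eq_negY_intCast_of_ne {P Q : W.geomPoints} {x₁ y₁ x₂ y₂ : AlgebraicClosure ℚ} {h₁ h₂}
    (hP : P = .some x₁ y₁ h₁) (hQ : Q = .some x₂ y₂ h₂) (hPQ : P ≠ Q) (hx : x₁ = x₂) :
    y₂ = -y₁ - ((integralModelInt W).a₁ : AlgebraicClosure ℚ) * x₁ -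
      ((integralModelInt W).a₃ : AlgebraicClosure ℚ) := by
  have e : @WeierstrassCurve.baseChange ℚ _ W (AlgebraicClosure ℚ) _
        (@AlgebraicClosure.instAlgebra ℚ _ ℚ _ _) =
      (integralModelInt W).map (Int.castRingHom (AlgebraicClosure ℚ)) := by
    conv_lhs => rw [← map_integralModelInt W]
    rw [baseChange, WeierstrassCurve.map_map]
    exact congrArg (integralModelInt W).map (RingHom.ext_int _ _)
  subst hx
  rcases Affine.Y_eq_of_X_eq h₂.left h₁.left rfl with hy | hy
  · exfalso
    apply hPQ
    rw [hP, hQ]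
    subst hy
    rfl
  · rw [hy, Affine.negY, congrArg WeierstrassCurve.a₁ e, congrArg WeierstrassCurve.a₃ e]
    rfl

section Supersingular

variable [W.IsElliptic] (hΔ : ¬ (ℓ : ℤ) ∣ minimalDiscriminantInt W)
  (hss : (ℓ : ℤ) ∣ W.frobeniusTrace ℓ) (hℓ2 : ℓ ≠ 2)
include hΔ hss hℓ2

/-- **`v(y)² = v(x)³` and `v(x) < v(y)` for a nonzero `ℓ`-torsion point `(x, y)`** at a good
supersingular `ℓ` (`v(x) > 1`, so `x³` dominates the right-hand side of the Weierstrass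
equation and `y²` the left-hand side). [cite: Serre1972, §1.11] -/
theorem valuation_X_lt_valuation_Y {P : W.geomPoints} (hP : (ℓ : ℤ) • P = 0)
    {x y : AlgebraicClosure ℚ} {h} (hPxy : P = .some x y h) :
    (placeOver ℓ).valuation x < (placeOver ℓ).valuation y ∧
      (placeOver ℓ).valuation y ^ 2 = (placeOver ℓ).valuation x ^ 3 := by
  have _ := hℓ2
  set v := (placeOver ℓ).valuation with hv
  have hx1 : 1 < v x := one_lt_valuation_of_zsmul_eq_zero ℓ hΔ hss hP hPxy
  have heq := equation_intCast_of_eq_some (W := W) hPxy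
  set A₁ := ((integralModelInt W).a₁ : AlgebraicClosure ℚ) with hA₁
  set A₂ := ((integralModelInt W).a₂ : AlgebraicClosure ℚ) with hA₂
  set A₃ := ((integralModelInt W).a₃ : AlgebraicClosure ℚ) with hA₃
  set A₄ := ((integralModelInt W).a₄ : AlgebraicClosure ℚ) with hA₄
  set A₆ := ((integralModelInt W).a₆ : AlgebraicClosure ℚ) with hA₆
  have hint : ∀ n : ℤ, v (n : AlgebraicClosure ℚ) ≤ 1 := by
    intro n
    rcases em ((ℓ : ℤ) ∣ n) with hn | hn
    · exact ((valuation_placeOver_intCast_lt_one_iff ℓ).mpr hn).le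
    · exact (valuation_placeOver_intCast_eq_one ℓ hn).le
  set ν := v x with hν
  set μ := v y with hμ
  have hν0 : ν ≠ 0 := by rintro h0; rw [h0] at hx1; exact not_lt_zero hx1
  have hν2 : ν < ν ^ 2 := by
    conv_lhs => rw [← pow_one ν]
    exact pow_lt_pow_right₀ hx1 one_lt_two
  have hν23 : ν ^ 2 < ν ^ 3 := pow_lt_pow_right₀ hx1 (by norm_num)
  have hν12 : (1 : (placeOver ℓ).ValueGroup) ≤ ν ^ 2 := (hx1.trans hν2).le
  -- the right-hand side has valuation `ν³`
  have hrest : v (A₂ * x ^ 2 + A₄ * x + A₆) ≤ ν ^ 2 := by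
    refine Valuation.map_add_le _ (Valuation.map_add_le _ ?_ ?_) ((hint _).trans hν12)
    · rw [map_mul, map_pow]
      calc v A₂ * ν ^ 2 ≤ 1 * ν ^ 2 := mul_le_mul' (hint _) le_rfl
        _ = ν ^ 2 := one_mul _
    · rw [map_mul]
      calc v A₄ * ν ≤ 1 * ν ^ 2 := mul_le_mul' (hint _) hν2.le
        _ = ν ^ 2 := one_mul _
  have hRHS : v (x ^ 3 + A₂ * x ^ 2 + A₄ * x + A₆) = ν ^ 3 := by
    rw [add_assoc, add_assoc, ← add_assoc (A₂ * x ^ 2),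
      Valuation.map_add_eq_of_lt_left _ (by rw [map_pow]; exact hrest.trans_lt hν23), map_pow]
  -- Step 1: `μ > ν`
  have hνμ : ν < μ := by
    by_contra hle
    rw [not_lt] at hle
    have hLHS : v (y ^ 2 + A₁ * x * y + A₃ * y) ≤ ν ^ 2 := by
      refine Valuation.map_add_le _ (Valuation.map_add_le _ ?_ ?_) ?_
      · rw [map_pow, sq, sq]; exact mul_le_mul' hle hle
      · rw [map_mul, map_mul, sq]
        calc v A₁ * ν * μ ≤ 1 * ν * ν := mul_le_mul' (mul_le_mul' (hint _) le_rfl) hle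
          _ = ν * ν := by rw [one_mul]
      · rw [map_mul]
        calc v A₃ * μ ≤ 1 * ν := mul_le_mul' (hint _) hle
          _ = ν := one_mul _
          _ ≤ ν ^ 2 := hν2.le
    rw [heq, hRHS] at hLHS
    exact absurd hLHS (not_le.mpr hν23)
  have hμ0 : μ ≠ 0 := ne_of_gt (lt_trans (zero_lt_iff.mpr hν0) hνμ)
  have hμ1 : 1 < μ := hx1.trans hνμ
  refine ⟨hνμ, ?_⟩
  -- Step 2: `v(LHS) = μ²`
  have hsmall : v (A₁ * x * y + A₃ * y) < μ ^ 2 := by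
    refine Valuation.map_add_lt _ ?_ ?_
    · rw [map_mul, map_mul, sq]
      calc v A₁ * ν * μ ≤ 1 * ν * μ := mul_le_mul' (mul_le_mul' (hint _) le_rfl) le_rfl
        _ = μ * ν := by rw [one_mul, mul_comm]
        _ < μ * μ := mul_lt_mul_left_of_ne_zero hμ0 hνμ
    · rw [map_mul, sq]
      calc v A₃ * μ ≤ 1 * μ := mul_le_mul' (hint _) le_rfl
        _ = μ * 1 := by rw [one_mul, mul_one]
        _ < μ * μ := mul_lt_mul_left_of_ne_zero hμ0 hμ1
  have hLHS : v (y ^ 2 + A₁ * x * y + A₃ * y) = μ ^ 2 := by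
    rw [add_assoc, Valuation.map_add_eq_of_lt_left _ (by rw [map_pow]; exact hsmall), map_pow]
  rw [← hLHS, heq, hRHS]

/-- **The parameter `t = x/y` of a nonzero `ℓ`-torsion point has `v(t)² v(x) = 1`** (and
`y ≠ 0`). [cite: Serre1972, §1.11] -/
theorem valuation_param_sq_mul {P : W.geomPoints} (hP : (ℓ : ℤ) • P = 0)
    {x y : AlgebraicClosure ℚ} {h} (hPxy : P = .some x y h) :
    y ≠ 0 ∧ (placeOver ℓ).valuation (x / y) ^ 2 * (placeOver ℓ).valuation x = 1 := by
  set v := (placeOver ℓ).valuation with hv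
  have hx1 : 1 < v x := one_lt_valuation_of_zsmul_eq_zero ℓ hΔ hss hP hPxy
  obtain ⟨hνμ, hμ2⟩ := valuation_X_lt_valuation_Y ℓ hΔ hss hℓ2 hP hPxy
  have hν0 : v x ≠ 0 := by rintro h0; rw [h0] at hx1; exact not_lt_zero hx1
  have hμ0 : v y ≠ 0 := ne_of_gt (lt_trans (zero_lt_iff.mpr hν0) hνμ)
  have hy0 : y ≠ 0 := fun h0 ↦ hμ0 (by rw [h0, map_zero])
  refine ⟨hy0, ?_⟩
  rw [map_div₀, div_pow, hμ2, div_mul_eq_mul_div, ← pow_succ, div_self (pow_ne_zero 3 hν0)]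

/-- **`v(t)^{ℓ² - 1} = v(ℓ)` and `v(t) < 1`: the parameters of the nonzero `ℓ`-torsion points
have valuation `1/(ℓ² - 1)`** (`e = 1`; Serre 1972, §1.11, Prop. 12: `E_p` is a formal group of
height `2`, its points of order `p` have `v(t) = 1/(p² - 1)`).  From `v(t)² v(x) = 1` and
`v(x)^d v(ℓ) = 1`, `2d = ℓ² - 1`. [cite: Serre1972, §1.11 Prop. 12] -/
theorem valuation_param_pow_eq {P : W.geomPoints} (hP : (ℓ : ℤ) • P = 0)
    {x y : AlgebraicClosure ℚ} {h} (hPxy : P = .some x y h) :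
    (placeOver ℓ).valuation (x / y) < 1 ∧
      (placeOver ℓ).valuation (x / y) ^ (ℓ ^ 2 - 1) = (placeOver ℓ).valuation ℓ := by
  have hp : ℓ.Prime := Fact.out
  set v := (placeOver ℓ).valuation with hv
  set d := (ℓ ^ 2 - 1) / 2 with hd
  have hx1 : 1 < v x := one_lt_valuation_of_zsmul_eq_zero ℓ hΔ hss hP hPxy
  obtain ⟨-, hτ⟩ := valuation_param_sq_mul ℓ hΔ hss hℓ2 hP hPxy
  obtain ⟨-, hxd⟩ := valuation_pow_mul_eq_one_of_isRoot ℓ hΔ hss hℓ2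
    (isRoot_preΨ'_of_zsmul_eq_zero ℓ hℓ2 hP hPxy)
  have hν0 : v x ≠ 0 := by rintro h0; rw [h0] at hx1; exact not_lt_zero hx1
  set τ := v (x / y) with hτdef
  have h2d : 2 * d = ℓ ^ 2 - 1 := by
    have hodd : Odd ℓ := hp.odd_of_ne_two hℓ2
    have heven : Even (ℓ ^ 2 - 1) := by
      rcases hodd with ⟨k, hk⟩
      refine ⟨2 * k ^ 2 + 2 * k, ?_⟩
      rw [hk]; ring_nf; omega
    rw [hd]; exact Nat.two_mul_div_two_of_even heven
  refine ⟨?_, ?_⟩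
  · -- `τ < 1` since `τ² v(x) = 1` and `v(x) > 1`
    by_contra hle
    rw [not_lt] at hle
    have h1 : v x ≤ τ ^ 2 * v x := by
      calc v x = 1 * v x := (one_mul _).symm
        _ ≤ τ ^ 2 * v x := by
          refine mul_le_mul' ?_ le_rfl
          rw [sq]
          calc (1 : (placeOver ℓ).ValueGroup) = 1 * 1 := (mul_one 1).symm
            _ ≤ τ * τ := mul_le_mul' hle hle
    rw [hτ] at h1
    exact absurd h1 (not_le.mpr hx1)
  · have h1 : (τ ^ 2) ^ d * v x ^ d = 1 := by rw [← mul_pow, hτ, one_pow]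
    calc τ ^ (ℓ ^ 2 - 1) = (τ ^ 2) ^ d := by rw [← pow_mul, h2d]
      _ = (τ ^ 2) ^ d * (v x ^ d * v ℓ) := by rw [hxd, mul_one]
      _ = v ℓ := by rw [← mul_assoc, h1, one_mul]

/-- **Distinct nonzero `ℓ`-torsion points have parameters as far apart as possible:
`v(t(P) - t(Q)) = v(t(P))` for `P ≠ Q`** (`t = x/y`), at a good supersingular odd prime `ℓ`.
If `x(P) ≠ x(Q)`: from `y² = x³ + R` with `v(R) ≤ v(x)v(y) < v(x)³` one gets
`t² = x²/y²` with `v(t(P)² - t(Q)²) = v(x(P) - x(Q)) v(x)⁴ / v(y)⁴ = v(t)²`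
(`valuation_sub_eq_of_isRoot`: `v(x(P) - x(Q)) = v(x)`), whence `v(t(P) ± t(Q)) = v(t)`.  If
`x(P) = x(Q)` then `Q = -P`, `t(P) - t(Q) = x(2y + a₁x + a₃)/(y y')` has valuation `v(t)` as
`ℓ ≠ 2`.  (Serre obtains this from the formal group: `E_p ∖ 0 → 𝔪_{1/(p²-1)}/𝔪⁺` is injective,
§1.9–1.10.) [cite: Serre1972, §1.10–1.11, Prop. 10 and Prop. 12] -/
theorem valuation_param_sub_eq {P Q : W.geomPoints} (hP : (ℓ : ℤ) • P = 0) (hQ : (ℓ : ℤ) • Q = 0)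
    (hPQ : P ≠ Q) {x₁ y₁ x₂ y₂ : AlgebraicClosure ℚ} {h₁ h₂} (hP₁ : P = .some x₁ y₁ h₁)
    (hQ₂ : Q = .some x₂ y₂ h₂) :
    (placeOver ℓ).valuation (x₁ / y₁ - x₂ / y₂) = (placeOver ℓ).valuation (x₁ / y₁) := by
  have hp : ℓ.Prime := Fact.out
  set v := (placeOver ℓ).valuation with hv
  have hint : ∀ n : ℤ, v (n : AlgebraicClosure ℚ) ≤ 1 := by
    intro n
    rcases em ((ℓ : ℤ) ∣ n) with hn | hn
    · exact ((valuation_placeOver_intCast_lt_one_iff ℓ).mpr hn).le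
    · exact (valuation_placeOver_intCast_eq_one ℓ hn).le
  set A₁ := ((integralModelInt W).a₁ : AlgebraicClosure ℚ) with hA₁
  set A₂ := ((integralModelInt W).a₂ : AlgebraicClosure ℚ) with hA₂
  set A₃ := ((integralModelInt W).a₃ : AlgebraicClosure ℚ) with hA₃
  set A₄ := ((integralModelInt W).a₄ : AlgebraicClosure ℚ) with hA₄
  set A₆ := ((integralModelInt W).a₆ : AlgebraicClosure ℚ) with hA₆
  -- valuations of the coordinates: `ν = v x`, `μ = v y`, the same for `P` and `Q`
  have hx1 : 1 < v x₁ := one_lt_valuation_of_zsmul_eq_zero ℓ hΔ hss hP hP₁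
  obtain ⟨hνμ, hμ2⟩ := valuation_X_lt_valuation_Y ℓ hΔ hss hℓ2 hP hP₁
  obtain ⟨hy₁, hτ⟩ := valuation_param_sq_mul ℓ hΔ hss hℓ2 hP hP₁
  obtain ⟨hνμ', hμ2'⟩ := valuation_X_lt_valuation_Y ℓ hΔ hss hℓ2 hQ hQ₂
  obtain ⟨hy₂, hτ'⟩ := valuation_param_sq_mul ℓ hΔ hss hℓ2 hQ hQ₂
  have hr₁ := isRoot_preΨ'_of_zsmul_eq_zero ℓ hℓ2 hP hP₁
  have hr₂ := isRoot_preΨ'_of_zsmul_eq_zero ℓ hℓ2 hQ hQ₂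
  obtain ⟨-, hxd₁⟩ := valuation_pow_mul_eq_one_of_isRoot ℓ hΔ hss hℓ2 hr₁
  obtain ⟨-, hxd₂⟩ := valuation_pow_mul_eq_one_of_isRoot ℓ hΔ hss hℓ2 hr₂
  set ν := v x₁ with hν
  set μ := v y₁ with hμ
  have hν0 : ν ≠ 0 := by rintro h0; rw [h0] at hx1; exact not_lt_zero hx1
  have hμ0 : μ ≠ 0 := ne_of_gt (lt_trans (zero_lt_iff.mpr hν0) hνμ)
  have hμ1 : 1 < μ := hx1.trans hνμ
  have hvℓ0 : v ℓ ≠ 0 := by rw [hv, Valuation.ne_zero_iff]; exact_mod_cast hp.ne_zero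
  have hd0 : (ℓ ^ 2 - 1) / 2 ≠ 0 := by
    have h3 : 3 ≤ ℓ := by have := hp.two_le; omega
    have : 9 ≤ ℓ ^ 2 := by nlinarith
    omega
  have hνν : v x₂ = ν :=
    pow_left_injective_of_ne_zero hd0 (mul_right_cancel₀ hvℓ0 (hxd₂.trans hxd₁.symm))
  have hμμ : v y₂ = μ := by
    have : v y₂ ^ 2 = μ ^ 2 := by rw [hμ2', hνν, hμ2]
    exact pow_left_injective_of_ne_zero two_ne_zero this
  set τ := v (x₁ / y₁) with hτdef
  have hτν : τ * μ = ν := by rw [hτdef, map_div₀, div_mul_cancel₀ _ hμ0]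
  have hτ0 : τ ≠ 0 := by
    intro h0; rw [h0, zero_mul] at hτν; exact hν0 hτν.symm
  have hττ : v (x₂ / y₂) = τ := by rw [map_div₀, hνν, hμμ, hτdef, map_div₀]
  -- the generic bound `v(t₁ - t₂) ≤ τ`
  have hle : v (x₁ / y₁ - x₂ / y₂) ≤ τ :=
    Valuation.map_sub_le _ le_rfl (by rw [hττ])
  by_cases hx : x₁ = x₂
  · -- same abscissa: `Q = -P`, `y₂ = -y₁ - a₁ x₁ - a₃`
    have hy₂eq := eq_negY_intCast_of_ne (W := W) hP₁ hQ₂ hPQ hx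
    have hv2 : v (2 : AlgebraicClosure ℚ) = 1 := by
      have h2 : ¬ (ℓ : ℤ) ∣ 2 := fun h ↦ hℓ2 (by
        have := Int.le_of_dvd two_pos h
        have h2' : (2 : ℤ) ≤ ℓ := by exact_mod_cast hp.two_le
        omega)
      have := valuation_placeOver_intCast_eq_one ℓ h2
      push_cast at this
      exact this
    have hsmall : v (A₁ * x₁ + A₃) < μ := by
      refine lt_of_le_of_lt (Valuation.map_add_le _ ?_ ((hint _).trans hx1.le)) hνμ
      rw [map_mul]
      calc v A₁ * ν ≤ 1 * ν := mul_le_mul' (hint _) le_rfl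
        _ = ν := one_mul _
    have hdiff : v (y₂ - y₁) = μ := by
      have : y₂ - y₁ = -(2 * y₁ + (A₁ * x₁ + A₃)) := by rw [hy₂eq, hx]; ring
      rw [this, Valuation.map_neg,
        Valuation.map_add_eq_of_lt_left _ (by rwa [map_mul, hv2, one_mul]), map_mul, hv2, one_mul]
    have hvy₂ : v y₂ = μ := hμμ
    have key : x₁ / y₁ - x₂ / y₂ = x₁ * (y₂ - y₁) / (y₁ * y₂) := by
      rw [← hx, div_sub_div _ _ hy₁ hy₂]; ring
    rw [key, map_div₀, map_mul, map_mul, hdiff, hvy₂]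
    -- `ν μ / (μ μ) = τ`
    rw [div_eq_iff (mul_ne_zero hμ0 hμ0), show v x₁ = τ * μ from hτν.symm, mul_assoc]
  · -- distinct abscissae
    have hxx : v (x₁ - x₂) = ν := valuation_sub_eq_of_isRoot ℓ hΔ hss hℓ2 hr₁ hr₂ hx
    -- `y² = x³ + R` with `v R ≤ ν μ`
    have heq₁ := equation_intCast_of_eq_some (W := W) hP₁
    have heq₂ := equation_intCast_of_eq_some (W := W) hQ₂
    set R₁ := A₂ * x₁ ^ 2 + A₄ * x₁ + A₆ - A₁ * x₁ * y₁ - A₃ * y₁ with hR₁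
    set R₂ := A₂ * x₂ ^ 2 + A₄ * x₂ + A₆ - A₁ * x₂ * y₂ - A₃ * y₂ with hR₂
    have hy₁sq : y₁ ^ 2 = x₁ ^ 3 + R₁ := by rw [hR₁]; linear_combination heq₁
    have hy₂sq : y₂ ^ 2 = x₂ ^ 3 + R₂ := by rw [hR₂]; linear_combination heq₂
    have hν1 : (1 : (placeOver ℓ).ValueGroup) ≤ ν := hx1.le
    have hRbound : ∀ {x y : AlgebraicClosure ℚ}, v x = ν → v y = μ →
        v (A₂ * x ^ 2 + A₄ * x + A₆ - A₁ * x * y - A₃ * y) ≤ ν * μ := by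
      intro x y hxν hyμ
      have hνμ2 : ν * ν ≤ ν * μ := mul_le_mul' le_rfl hνμ.le
      have h1 : (1 : (placeOver ℓ).ValueGroup) ≤ ν * μ :=
        (one_mul (1 : (placeOver ℓ).ValueGroup)).symm.le.trans (mul_le_mul' hν1 hμ1.le)
      refine Valuation.map_sub_le _ (Valuation.map_sub_le _
        (Valuation.map_add_le _ (Valuation.map_add_le _ ?_ ?_) ((hint _).trans h1)) ?_) ?_
      · rw [map_mul, map_pow, hxν, sq]
        exact (mul_le_mul' (hint _) hνμ2).trans_eq (one_mul _)
      · rw [map_mul, hxν]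
        calc v A₄ * ν ≤ 1 * (ν * μ) := mul_le_mul' (hint _)
              ((mul_one ν).symm.le.trans (mul_le_mul' le_rfl hμ1.le))
          _ = ν * μ := one_mul _
      · rw [map_mul, map_mul, hxν, hyμ]
        exact (mul_le_mul' (mul_le_mul' (hint _) le_rfl) le_rfl).trans_eq (by rw [one_mul])
      · rw [map_mul, hyμ]
        calc v A₃ * μ ≤ 1 * (ν * μ) := mul_le_mul' (hint _)
              ((one_mul μ).symm.le.trans (mul_le_mul' hν1 le_rfl))
          _ = ν * μ := one_mul _
    have hvR₁ : v R₁ ≤ ν * μ := hRbound rfl rfl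
    have hvR₂ : v R₂ ≤ ν * μ := hRbound hνν hμμ
    -- `μ < ν²` (from `μ² = ν³ < ν⁴`)
    have hμν2 : μ < ν ^ 2 := by
      by_contra hle'
      rw [not_lt] at hle'
      have : ν ^ 2 * ν ^ 2 ≤ μ * μ := mul_le_mul' hle' hle'
      rw [← sq, ← sq, hμ2, ← pow_mul] at this
      exact absurd this (not_le.mpr (pow_lt_pow_right₀ hx1 (by norm_num)))
    -- the numerator `x₁² y₂² - x₂² y₁² = x₁² x₂² (x₂ - x₁) + (x₁² R₂ - x₂² R₁)` has valuation `ν⁵`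
    have hnum_eq : x₁ ^ 2 * y₂ ^ 2 - x₂ ^ 2 * y₁ ^ 2 =
        x₁ ^ 2 * x₂ ^ 2 * (x₂ - x₁) + (x₁ ^ 2 * R₂ - x₂ ^ 2 * R₁) := by
      rw [hy₁sq, hy₂sq]; ring
    have hxx' : v (x₂ - x₁) = ν := by rw [← neg_sub, Valuation.map_neg, hxx]
    have hmain : v (x₁ ^ 2 * x₂ ^ 2 * (x₂ - x₁)) = ν ^ 5 := by
      rw [map_mul, map_mul, map_pow, map_pow, hνν, hxx', ← pow_add, ← pow_succ]
    have herr : v (x₁ ^ 2 * R₂ - x₂ ^ 2 * R₁) < ν ^ 5 := by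
      have hb : ν ^ 2 * (ν * μ) < ν ^ 5 := by
        calc ν ^ 2 * (ν * μ) = ν ^ 3 * μ := by rw [← mul_assoc, ← pow_succ]
          _ < ν ^ 3 * ν ^ 2 := mul_lt_mul_left_of_ne_zero (pow_ne_zero _ hν0) hμν2
          _ = ν ^ 5 := by rw [← pow_add]
      refine lt_of_le_of_lt (Valuation.map_sub_le _ ?_ ?_) hb
      · rw [map_mul, map_pow]; exact mul_le_mul' le_rfl hvR₂
      · rw [map_mul, map_pow, hνν]; exact mul_le_mul' le_rfl hvR₁
    have hnum : v (x₁ ^ 2 * y₂ ^ 2 - x₂ ^ 2 * y₁ ^ 2) = ν ^ 5 := by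
      rw [hnum_eq, Valuation.map_add_eq_of_lt_left _ (by rw [hmain]; exact herr), hmain]
    -- hence `v(t₁² - t₂²) = τ²`
    have hsq : v ((x₁ / y₁) ^ 2 - (x₂ / y₂) ^ 2) = τ ^ 2 := by
      have key : (x₁ / y₁) ^ 2 - (x₂ / y₂) ^ 2 =
          (x₁ ^ 2 * y₂ ^ 2 - x₂ ^ 2 * y₁ ^ 2) / (y₁ ^ 2 * y₂ ^ 2) := by
        rw [div_pow, div_pow, div_sub_div _ _ (pow_ne_zero 2 hy₁) (pow_ne_zero 2 hy₂)]
        ring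
      rw [key, map_div₀, hnum, map_mul, map_pow, map_pow, hμμ,
        div_eq_iff (mul_ne_zero (pow_ne_zero _ hμ0) (pow_ne_zero _ hμ0))]
      -- `ν⁵ = τ² μ² μ²`: `τ μ = ν`, `μ² = ν³`
      calc ν ^ 5 = ν ^ 2 * ν ^ 3 := by rw [← pow_add]
        _ = (τ * μ) ^ 2 * μ ^ 2 := by rw [hτν, hμ2]
        _ = τ ^ 2 * (μ ^ 2 * μ ^ 2) := by rw [mul_pow, mul_assoc]
    -- and `v(t₁ - t₂) = τ` (both `v(t₁ ± t₂) ≤ τ`, product `τ²`)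
    have hplus : v (x₁ / y₁ + x₂ / y₂) ≤ τ := Valuation.map_add_le _ le_rfl (by rw [hττ])
    refine le_antisymm hle (not_lt.mp fun hlt ↦ ?_)
    have : v ((x₁ / y₁) ^ 2 - (x₂ / y₂) ^ 2) < τ ^ 2 := by
      rw [sq_sub_sq, map_mul, sq]
      calc v (x₁ / y₁ + x₂ / y₂) * v (x₁ / y₁ - x₂ / y₂)
          ≤ τ * v (x₁ / y₁ - x₂ / y₂) := mul_le_mul' hplus le_rfl
        _ < τ * τ := mul_lt_mul_left_of_ne_zero hτ0 hlt
    exact this.ne hsq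

end Supersingular

end Literature.NumberTheory.EllipticCurves
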